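/-
Copyright (c) 2026 the pub-hodgecm-mathlib formalisation cell (harness21).  Prover seat hodgecm-mathlib-F0P2-p01 (g15): road «S3-ram» (LEAD F0P3a-plan (g12); architect
A-p16 (g31); junction pen F0P3a-p01 (g17), J-PACK v2 03ef5f1f ROW-C; owner F0P3a-p06 (g15)); 2026-09-02.
-/
import Literature.NumberTheory.Automorphic.UnitaryLatticeTreeFixedRowEvenRamified   -- ★ ROW-E p847526 (this seat): template, `conj_mul_eq_inv_mul_conj_mul`; brings ★ M₂, M, L, K, J, I, H, G3, G3⁺, G3⁵
import HarnessLib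

/-!
# The lattice graph of a hermitian space — ROW-C OF THE TREE INDUCTION (tame-ramified place): a RANK-ONE vertex of depth ONE is a LEAF of the fixed subtree
# (Bruhat–Tits 1972 §10; Tits 1979 §3.5; Kottwitz 1986 §3)

Topic `NumberTheory/Automorphic`; namespace `Literature.NumberTheory.Automorphic.UnitaryLatticeTree`.  THEOREMS ONLY (no definition, no instance, no notation, no named fact,
no `sorry`); kernel lane `--supports stmt-HodgeConjecture-24833`.  Cell `pub/hodgecm-mathlib` (D-0151), crux H413; road «S3-ram» (Literature seeding, count-neutral), organ
A′ (ii) of the P-1-ram skeleton (architect A-p16 (g31)); junction J-PACK v2 (F0P3a-p01 (g17)) **ROW-C** «RANK-ONE DEPTH-ONE VERTICES ARE LEAVES», the `hC` hypothesis of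
the engine ★ p847302 in TOKEN currency (socket `row_C` of the junction skeleton; binder order verbatim; `hT`, `hγ0` unused `_`-binders).  J₀-MODEL.

THE STATEMENT.  For a fixed self-dual vertex `v ≠ r₀` with `LEV[v] ϖ`, `¬LEV[v](ϖ²)` (depth exactly one), `LEV₂[v](ϖ³)` (rank `≤ 1`), `LEV₃[v](ϖ⁴)`, oriented by
`(p, g, hup)` (`LEV[g] ϖ`): **`GC(v) = ∅`** — the vertex `C^±` has no fixed grandchildren (CERT smoke v1.3 §6: collar leaves).

THE PROOF.  As in ROW-P (★ p847526 ∕ ROW-P): in the inward-adapted unitary frame `u₀ = uκ₀` the element `Y₀` has the rank-one shape `Ȳ₀ = s·E₀₂`, `|Y₀ 0 2| = |ϖ|`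
(★ J §1+§2, ★ K); a fixed grandchild `w` would sit over an OUTWARD neighbour `c = (uκ)·N₁` (★ L) with `k = κ₀⁻¹κ`, `|k₂₀| = 1`, whose corner `((uκ)⁻¹(γ−1)(uκ))₂₀`
is a UNIT multiple of `ϖ` (★ K `v_conj_apply_two_zero_le_iff_of_shape`): the residual test FAILS at `c`, so NO self-dual vertex `≠ v` adjacent to `c` is fixed (★ G3
`v_B₀_lt_one_of_exists_fixed_child_latticeGraphIso_of_congr`, all-or-none) — contradiction with `w`.

* **`fixedGrandchildren_eq_empty_of_rankOne_depthOne`** (ROW-C).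

HONEST LABEL: HC_CM is proved only modulo the 2 remaining named inputs (hLiu418 24832, h413 24833) until rung 0 closes; nothing printed is asserted here (elementary lattice
bookkeeping over a valuation ring); «S3-ram» has no books consequence.

## References
* [BruhatTits1972] F. Bruhat, J. Tits, *Groupes réductifs sur un corps local I*, Publ. Math. IHÉS 41 (1972), §10 (lattice models; vertex stabilisers and their filtrations).
* [Tits1979] J. Tits, *Reductive groups over local fields*, PSPM 33.1 (1979), §3.5 (congruence filtration; reduction mod `𝔭`).
* [Kottwitz1986] R. E. Kottwitz, *Base change for unit elements of Hecke algebras*, Compositio Math. 60 (1986), §3 (counting fixed lattices shell by shell).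
* [Serre1980Trees] J.-P. Serre, *Trees* (1980), Ch. II §1.1 (neighbours of a lattice = lines of its reduction).
-/

set_option autoImplicit false

noncomputable section

open scoped Valued WithZero Matrix MatrixGroups

namespace Literature.NumberTheory.Automorphic.UnitaryLatticeTree

open Literature.NumberTheory.Automorphic Literature.NumberTheory.Automorphic.HermitianLattice

variable {K : Type*} [Field K] [Valued K ℤᵐ⁰] {σ : K →+* K} {ϖ : K}

/-- **ROW-C «RANK-ONE DEPTH-ONE VERTICES ARE LEAVES»** of the (a2) tree induction, token currency (J-PACK v2 §2, socket `row_C`): for a fixed self-dual vertex `v ≠ r₀`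
with `LEV[v] ϖ`, `¬LEV[v](ϖ²)`, `LEV₂[v](ϖ³)`, `LEV₃[v](ϖ⁴)`, oriented by `(p, g, hup)`: `GC(v) = ∅`.
[cite: Kottwitz1986, §3] [cite: Tits1979, §3.5] [cite: BruhatTits1972, §10] [cite: Serre1980Trees, II.1.1] -/
theorem fixedGrandchildren_eq_empty_of_rankOne_depthOne (hσ : ∀ x, σ (σ x) = x) (hvσ : ∀ a, Valued.v (σ a) = Valued.v a) (hσϖ : σ ϖ = -ϖ)
    (hϖ : Valued.v ϖ = WithZero.exp (-1 : ℤ)) (hres : ∀ x : K, Valued.v x ≤ 1 → Valued.v (σ x - x) < 1) (h2 : Valued.v (2 : K) = 1) [Finite 𝓀[K]]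
    (_hT : (latticeGraph σ ϖ ((StdForm.antidiagonal 3).over K)).IsTree)
    {γ : unitaryGroupOfForm σ ((StdForm.antidiagonal 3).over K)} (_hγ0 : γ ∈ unitaryInt σ ((StdForm.antidiagonal 3).over K))
    {v : {M : Submodule 𝒪[K] (Fin 3 → K) // IsVertex σ ϖ ((StdForm.antidiagonal 3).over K) M}}
    (hv : IsSelfDualLattice σ ϖ ((StdForm.antidiagonal 3).over K) v.1) (hvr : v ≠ ⟨stdLattice K 3, 0, isSelfDualLattice_stdLattice_three_of_v hϖ⟩)
    (hfix : latticeGraphIso σ ϖ ((StdForm.antidiagonal 3).over K) γ v = v)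
    {p g : {M : Submodule 𝒪[K] (Fin 3 → K) // IsVertex σ ϖ ((StdForm.antidiagonal 3).over K) M}}
    (hp : (latticeGraph σ ϖ ((StdForm.antidiagonal 3).over K)).Adj v p)
    (hpin : (latticeGraph σ ϖ ((StdForm.antidiagonal 3).over K)).dist ⟨stdLattice K 3, 0, isSelfDualLattice_stdLattice_three_of_v hϖ⟩ p + 1 =
      (latticeGraph σ ϖ ((StdForm.antidiagonal 3).over K)).dist ⟨stdLattice K 3, 0, isSelfDualLattice_stdLattice_three_of_v hϖ⟩ v)
    (hg : (latticeGraph σ ϖ ((StdForm.antidiagonal 3).over K)).Adj p g) (hgv : g ≠ v)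
    (hup : g.1.map ((Matrix.toLin' (((γ : GL (Fin 3) K) : Matrix (Fin 3) (Fin 3) K) - 1)).restrictScalars 𝒪[K]) ≤ scaleLattice (ϖ) g.1)
    (hlev : v.1.map ((Matrix.toLin' (((γ : GL (Fin 3) K) : Matrix (Fin 3) (Fin 3) K) - 1)).restrictScalars 𝒪[K]) ≤ scaleLattice (ϖ) v.1)
    (hexact : ¬ v.1.map ((Matrix.toLin' (((γ : GL (Fin 3) K) : Matrix (Fin 3) (Fin 3) K) - 1)).restrictScalars 𝒪[K]) ≤ scaleLattice (ϖ ^ 2) v.1)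
    (hrk : v.1.map ((Matrix.toLin' ((((γ : GL (Fin 3) K) : Matrix (Fin 3) (Fin 3) K) - 1) ^ 2)).restrictScalars 𝒪[K]) ≤ scaleLattice (ϖ ^ 3) v.1)
    (hnil : v.1.map ((Matrix.toLin' ((((γ : GL (Fin 3) K) : Matrix (Fin 3) (Fin 3) K) - 1) ^ 3)).restrictScalars 𝒪[K]) ≤ scaleLattice (ϖ ^ 4) v.1) :
    {w | ∃ c, ((latticeGraph σ ϖ ((StdForm.antidiagonal 3).over K)).Adj v c ∧
          (latticeGraph σ ϖ ((StdForm.antidiagonal 3).over K)).dist ⟨stdLattice K 3, 0, isSelfDualLattice_stdLattice_three_of_v hϖ⟩ c =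
            (latticeGraph σ ϖ ((StdForm.antidiagonal 3).over K)).dist ⟨stdLattice K 3, 0, isSelfDualLattice_stdLattice_three_of_v hϖ⟩ v + 1 ∧
          latticeGraphIso σ ϖ ((StdForm.antidiagonal 3).over K) γ c = c) ∧
        ((latticeGraph σ ϖ ((StdForm.antidiagonal 3).over K)).Adj c w ∧
          (latticeGraph σ ϖ ((StdForm.antidiagonal 3).over K)).dist ⟨stdLattice K 3, 0, isSelfDualLattice_stdLattice_three_of_v hϖ⟩ w =
            (latticeGraph σ ϖ ((StdForm.antidiagonal 3).over K)).dist ⟨stdLattice K 3, 0, isSelfDualLattice_stdLattice_three_of_v hϖ⟩ c + 1 ∧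
          latticeGraphIso σ ϖ ((StdForm.antidiagonal 3).over K) γ w = w)} = ∅ := by
  have hϖ0 : ϖ ≠ 0 := fun h0 => by rw [h0, map_zero] at hϖ; exact WithZero.coe_ne_zero hϖ.symm
  have hvϖ0 : Valued.v ϖ ≠ 0 := (Valuation.ne_zero_iff _).2 hϖ0
  have hϖlt : Valued.v ϖ < 1 := by rw [hϖ, ← WithZero.exp_zero]; exact WithZero.exp_lt_exp.2 (by norm_num)
  have hdm : ∀ n : ℕ, Valued.v ϖ ^ n = Valued.v ϖ ^ (n + 1) * WithZero.exp (1 : ℤ) := fun n => by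
    rw [pow_succ, hϖ, mul_assoc, ← WithZero.exp_add]; norm_num
  -- the frame of `v`
  obtain ⟨u, hu⟩ := exists_latticeGraphIso_root_eq_of_v_two hσ hvσ hϖ h2 v hv (isSelfDualLattice_stdLattice_three_of_v hϖ)
  subst hu
  have hγK : u⁻¹ * γ * u ∈ unitaryInt σ ((StdForm.antidiagonal 3).over K) := mem_unitaryInt_conj_of_latticeGraphIso_apply_root_eq hfix
  have hγϖ : ∀ i j, Valued.v (((((u⁻¹ * γ * u : unitaryGroupOfForm σ ((StdForm.antidiagonal 3).over K)) : GL (Fin 3) K) : Matrix (Fin 3) (Fin 3) K) - 1) i j) ≤ Valued.v ϖ :=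
    (forall_v_conj_sub_one_le_iff_map_sub_one_le_scaleLattice γ u hϖ0).1 hlev
  have hframe : ∀ {κ : unitaryGroupOfForm σ ((StdForm.antidiagonal 3).over K)}, κ ∈ unitaryInt σ ((StdForm.antidiagonal 3).over K) →
      latticeGraphIso σ ϖ ((StdForm.antidiagonal 3).over K) (u * κ) ⟨stdLattice K 3, 0, isSelfDualLattice_stdLattice_three_of_v hϖ⟩ =
        latticeGraphIso σ ϖ ((StdForm.antidiagonal 3).over K) u ⟨stdLattice K 3, 0, isSelfDualLattice_stdLattice_three_of_v hϖ⟩ := fun {κ} hκ => by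
    rw [latticeGraphIso_mul_apply, latticeGraphIso_root_eq_of_mem_unitaryInt hϖ hκ]
  -- token ↔ matrix dictionary at `d = 1`
  have hY : ∀ {κ : unitaryGroupOfForm σ ((StdForm.antidiagonal 3).over K)}, κ ∈ unitaryInt σ ((StdForm.antidiagonal 3).over K) →
      ∀ i j, Valued.v ((((((u * κ)⁻¹ * γ * (u * κ) : unitaryGroupOfForm σ ((StdForm.antidiagonal 3).over K)) : GL (Fin 3) K) : Matrix (Fin 3) (Fin 3) K) - 1) i j) ≤ Valued.v ϖ ^ 1 := fun {κ} hκ => by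
    have h := (map_pow_le_scaleLattice_latticeGraphIso_root_iff hϖ γ (u * κ) hϖ0 1).1 (by rw [pow_one, hframe hκ]; exact hlev)
    simpa only [pow_one] using h
  have hY2 : ∀ {κ : unitaryGroupOfForm σ ((StdForm.antidiagonal 3).over K)}, κ ∈ unitaryInt σ ((StdForm.antidiagonal 3).over K) →
      ∀ i j, Valued.v (((((((u * κ)⁻¹ * γ * (u * κ) : unitaryGroupOfForm σ ((StdForm.antidiagonal 3).over K)) : GL (Fin 3) K) : Matrix (Fin 3) (Fin 3) K) - 1) *
        (((((u * κ)⁻¹ * γ * (u * κ) : unitaryGroupOfForm σ ((StdForm.antidiagonal 3).over K)) : GL (Fin 3) K) : Matrix (Fin 3) (Fin 3) K) - 1)) i j) ≤ Valued.v ϖ ^ (2 * 1 + 1) := fun {κ} hκ => by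
    have h := (map_pow_le_scaleLattice_latticeGraphIso_root_iff hϖ γ (u * κ) (pow_ne_zero 3 hϖ0) 2).1 (by rw [hframe hκ]; exact hrk)
    simpa only [pow_two, map_pow] using h
  have hY3 : ∀ {κ : unitaryGroupOfForm σ ((StdForm.antidiagonal 3).over K)}, κ ∈ unitaryInt σ ((StdForm.antidiagonal 3).over K) →
      ∀ i j, Valued.v (((((((u * κ)⁻¹ * γ * (u * κ) : unitaryGroupOfForm σ ((StdForm.antidiagonal 3).over K)) : GL (Fin 3) K) : Matrix (Fin 3) (Fin 3) K) - 1) *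
        (((((u * κ)⁻¹ * γ * (u * κ) : unitaryGroupOfForm σ ((StdForm.antidiagonal 3).over K)) : GL (Fin 3) K) : Matrix (Fin 3) (Fin 3) K) - 1) *
        (((((u * κ)⁻¹ * γ * (u * κ) : unitaryGroupOfForm σ ((StdForm.antidiagonal 3).over K)) : GL (Fin 3) K) : Matrix (Fin 3) (Fin 3) K) - 1)) i j) ≤ Valued.v ϖ ^ (3 * 1 + 1) := fun {κ} hκ => by
    have h := (map_pow_le_scaleLattice_latticeGraphIso_root_iff hϖ γ (u * κ) (pow_ne_zero 4 hϖ0) 3).1 (by rw [hframe hκ]; exact hnil)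
    simpa only [pow_three', map_pow] using h
  have hYne : ∀ {κ : unitaryGroupOfForm σ ((StdForm.antidiagonal 3).over K)}, κ ∈ unitaryInt σ ((StdForm.antidiagonal 3).over K) →
      ¬ ∀ i j, Valued.v ((((((u * κ)⁻¹ * γ * (u * κ) : unitaryGroupOfForm σ ((StdForm.antidiagonal 3).over K)) : GL (Fin 3) K) : Matrix (Fin 3) (Fin 3) K) - 1) i j) ≤ Valued.v ϖ ^ (1 + 1) := fun {κ} hκ h => by
    apply hexact
    have h' := (map_pow_le_scaleLattice_latticeGraphIso_root_iff hϖ γ (u * κ) (pow_ne_zero 2 hϖ0) 1).2 (by simpa only [pow_one, map_pow] using h)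
    rwa [pow_one, hframe hκ] at h'
  -- ORIENTATION: the inward frame `u₀ = uκ₀`
  obtain ⟨κ₀, hκ₀, a₀, b₀, ha₀, hb₀, hp_eq, hg_eq⟩ := exists_frame_of_adj_adj hσ hvσ hσϖ hϖ hres h2 u rfl hp hg hgv
  set γ₀ : unitaryGroupOfForm σ ((StdForm.antidiagonal 3).over K) := (u * κ₀)⁻¹ * γ * (u * κ₀) with hγ₀def
  have hM₀ : (((γ₀ : GL (Fin 3) K) : Matrix (Fin 3) (Fin 3) K) - 1) = (((((u * κ₀ : unitaryGroupOfForm σ ((StdForm.antidiagonal 3).over K)) : GL (Fin 3) K)⁻¹ : GL (Fin 3) K) : Matrix (Fin 3) (Fin 3) K) * (((γ : GL (Fin 3) K) : Matrix (Fin 3) (Fin 3) K) - 1) * (((u * κ₀ : unitaryGroupOfForm σ ((StdForm.antidiagonal 3).over K)) : GL (Fin 3) K) : Matrix (Fin 3) (Fin 3) K)) := coe_inv_mul_mul_sub_one γ (u * κ₀)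
  have hY₀ : ∀ i j, Valued.v ((((((u * κ₀ : unitaryGroupOfForm σ ((StdForm.antidiagonal 3).over K)) : GL (Fin 3) K)⁻¹ : GL (Fin 3) K) : Matrix (Fin 3) (Fin 3) K) * (((γ : GL (Fin 3) K) : Matrix (Fin 3) (Fin 3) K) - 1) * (((u * κ₀ : unitaryGroupOfForm σ ((StdForm.antidiagonal 3).over K)) : GL (Fin 3) K) : Matrix (Fin 3) (Fin 3) K)) i j) ≤ Valued.v ϖ ^ 1 := fun i j => by rw [← hM₀]; exact hY hκ₀ i j
  have hY₀2 : ∀ i j, Valued.v (((((((u * κ₀ : unitaryGroupOfForm σ ((StdForm.antidiagonal 3).over K)) : GL (Fin 3) K)⁻¹ : GL (Fin 3) K) : Matrix (Fin 3) (Fin 3) K) * (((γ : GL (Fin 3) K) : Matrix (Fin 3) (Fin 3) K) - 1) * (((u * κ₀ : unitaryGroupOfForm σ ((StdForm.antidiagonal 3).over K)) : GL (Fin 3) K) : Matrix (Fin 3) (Fin 3) K)) * (((((u * κ₀ : unitaryGroupOfForm σ ((StdForm.antidiagonal 3).over K)) : GL (Fin 3) K)⁻¹ : GL (Fin 3) K)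 : Matrix (Fin 3) (Fin 3) K) * (((γ : GL (Fin 3) K) : Matrix (Fin 3) (Fin 3) K) - 1) * (((u * κ₀ : unitaryGroupOfForm σ ((StdForm.antidiagonal 3).over K)) : GL (Fin 3) K) : Matrix (Fin 3) (Fin 3) K))) i j) ≤ Valued.v ϖ ^ (2 * 1 + 1) := fun i j => by rw [← hM₀]; exact hY2 hκ₀ i j
  have hY₀3 : ∀ i j, Valued.v (((((((u * κ₀ : unitaryGroupOfForm σ ((StdForm.antidiagonal 3).over K)) : GL (Fin 3) K)⁻¹ : GL (Fin 3) K) : Matrix (Fin 3) (Fin 3) K) * (((γ : GL (Fin 3) K) : Matrix (Fin 3) (Fin 3) K) - 1) * (((u * κ₀ : unitaryGroupOfForm σ ((StdForm.antidiagonal 3).over K)) : GL (Fin 3) K) : Matrix (Fin 3) (Fin 3) K)) * (((((u * κ₀ : unitaryGroupOfForm σ ((StdForm.antidiagonal 3).over K)) : GL (Fin 3) K)⁻¹ : GL (Fin 3) K) : Matrix (Fin 3) (Fin 3) K) * (((γ : GL (Fin 3) K) : Matrix (Fin 3) (Fin 3) K) - 1) * (((u * κ₀ : unitaryGroupOfForm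 σ ((StdForm.antidiagonal 3).over K)) : GL (Fin 3) K) : Matrix (Fin 3) (Fin 3) K)) * (((((u * κ₀ : unitaryGroupOfForm σ ((StdForm.antidiagonal 3).over K)) : GL (Fin 3) K)⁻¹ : GL (Fin 3) K) : Matrix (Fin 3) (Fin 3) K) * (((γ : GL (Fin 3) K) : Matrix (Fin 3) (Fin 3) K) - 1) * (((u * κ₀ : unitaryGroupOfForm σ ((StdForm.antidiagonal 3).over K)) : GL (Fin 3) K) : Matrix (Fin 3) (Fin 3) K))) i j) ≤ Valued.v ϖ ^ (3 * 1 + 1) := fun i j => by rw [← hM₀]; exact hY3 hκ₀ i j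
  -- the inward line is in the kernel (★ J §1 + §2)
  have hcol₀ : ∀ i, Valued.v ((((((u * κ₀ : unitaryGroupOfForm σ ((StdForm.antidiagonal 3).over K)) : GL (Fin 3) K)⁻¹ : GL (Fin 3) K) : Matrix (Fin 3) (Fin 3) K) * (((γ : GL (Fin 3) K) : Matrix (Fin 3) (Fin 3) K) - 1) * (((u * κ₀ : unitaryGroupOfForm σ ((StdForm.antidiagonal 3).over K)) : GL (Fin 3) K) : Matrix (Fin 3) (Fin 3) K)) i 0) ≤ Valued.v ϖ ^ (1 + 1) := by
    have hup' : (latt ((((u * κ₀ : unitaryGroupOfForm σ ((StdForm.antidiagonal 3).over K)) : GL (Fin 3) K) : Matrix (Fin 3) (Fin 3) K) * !![a₀ / ϖ, 0, 0; 0, 1, 0; b₀, 0, ϖ])).map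
          ((Matrix.toLin' (((γ : GL (Fin 3) K) : Matrix (Fin 3) (Fin 3) K) - 1)).restrictScalars 𝒪[K]) ≤
        scaleLattice (ϖ ^ 1) (latt ((((u * κ₀ : unitaryGroupOfForm σ ((StdForm.antidiagonal 3).over K)) : GL (Fin 3) K) : Matrix (Fin 3) (Fin 3) K) * !![a₀ / ϖ, 0, 0; 0, 1, 0; b₀, 0, ϖ])) := by
      rw [pow_one, ← hg_eq]; exact hup
    obtain ⟨h10, -, h20⟩ := v_apply_le_succ_of_map_sub_one_childLatt_le hϖ ((u * κ₀ : unitaryGroupOfForm σ ((StdForm.antidiagonal 3).over K)) : GL (Fin 3) K) (γ : GL (Fin 3) K) ha₀ hb₀ le_rfl hY₀ hup'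
    by_contra hnot
    rw [not_forall] at hnot
    obtain ⟨i, hi⟩ := hnot
    have hpiv := v_one_zero_eq_of_cube_le_of_corner hϖ hY₀ hY₀3 h20 (fun h => hi (h i))
    have hlt : Valued.v ϖ ^ (1 + 1) < Valued.v ϖ ^ 1 := by
      rw [pow_succ]; exact mul_lt_of_lt_one_right (zero_lt_iff.2 (pow_ne_zero _ hvϖ0)) hϖlt
    exact (lt_irrefl _) ((h10.trans_lt hlt).trans_eq hpiv.symm)
  -- the RANK-ONE SHAPE at depth one (★ K) and exact depth `|Y₀ 0 2| = |ϖ|`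
  have hshape : ∀ i j : Fin 3, ¬ (i = 0 ∧ j = 2) → Valued.v ((((((u * κ₀ : unitaryGroupOfForm σ ((StdForm.antidiagonal 3).over K)) : GL (Fin 3) K)⁻¹ : GL (Fin 3) K) : Matrix (Fin 3) (Fin 3) K) * (((γ : GL (Fin 3) K) : Matrix (Fin 3) (Fin 3) K) - 1) * (((u * κ₀ : unitaryGroupOfForm σ ((StdForm.antidiagonal 3).over K)) : GL (Fin 3) K) : Matrix (Fin 3) (Fin 3) K)) i j) ≤ Valued.v ϖ ^ (1 + 1) := by
    intro i j hij
    have h := forall_v_coe_sub_one_le_succ_of_sq_le_of_col hvσ hσϖ hϖ hres γ₀ odd_one (fun i j => by rw [hM₀]; exact hY₀ i j)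
      (fun i j => by rw [hM₀]; exact hY₀2 i j) (fun i => by rw [hM₀]; exact hcol₀ i) hij
    rwa [hM₀] at h
  have h02 : Valued.v ((((((u * κ₀ : unitaryGroupOfForm σ ((StdForm.antidiagonal 3).over K)) : GL (Fin 3) K)⁻¹ : GL (Fin 3) K) : Matrix (Fin 3) (Fin 3) K) * (((γ : GL (Fin 3) K) : Matrix (Fin 3) (Fin 3) K) - 1) * (((u * κ₀ : unitaryGroupOfForm σ ((StdForm.antidiagonal 3).over K)) : GL (Fin 3) K) : Matrix (Fin 3) (Fin 3) K)) 0 2) = Valued.v ϖ ^ 1 := by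
    by_contra hne
    have h' : Valued.v ((((((u * κ₀ : unitaryGroupOfForm σ ((StdForm.antidiagonal 3).over K)) : GL (Fin 3) K)⁻¹ : GL (Fin 3) K) : Matrix (Fin 3) (Fin 3) K) * (((γ : GL (Fin 3) K) : Matrix (Fin 3) (Fin 3) K) - 1) * (((u * κ₀ : unitaryGroupOfForm σ ((StdForm.antidiagonal 3).over K)) : GL (Fin 3) K) : Matrix (Fin 3) (Fin 3) K)) 0 2) < Valued.v ϖ ^ 1 := lt_of_le_of_ne (hY₀ 0 2) hne
    rw [hdm 1] at h'
    have h02' := (WithZero.lt_mul_exp_iff_le (pow_ne_zero _ hvϖ0)).1 h'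
    apply hYne hκ₀
    intro i j
    rw [hM₀]
    by_cases hij : i = 0 ∧ j = 2
    · obtain ⟨rfl, rfl⟩ := hij; exact h02'
    · exact hshape i j hij
  -- no fixed grandchild
  rw [Set.eq_empty_iff_forall_notMem]
  rintro w ⟨c', ⟨hvc, hdc, -⟩, hcw, hdw, hwfix⟩
  have hne : w ≠ latticeGraphIso σ ϖ ((StdForm.antidiagonal 3).over K) u ⟨stdLattice K 3, 0, isSelfDualLattice_stdLattice_three_of_v hϖ⟩ := by
    intro h; rw [h] at hdw; omega
  obtain ⟨κ, hκ, a, b, ha, hb, hc_eq, -⟩ := exists_frame_of_adj_adj hσ hvσ hσϖ hϖ hres h2 u rfl hvc hcw hne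
  have hcp : c' ≠ p := by intro h; rw [h] at hdc; omega
  set k : unitaryGroupOfForm σ ((StdForm.antidiagonal 3).over K) := κ₀⁻¹ * κ with hkdef
  have hk : k ∈ unitaryInt σ ((StdForm.antidiagonal 3).over K) := Subgroup.mul_mem _ (Subgroup.inv_mem _ hκ₀) hκ
  have hkN : ¬ Valued.v (((k : GL (Fin 3) K) : Matrix (Fin 3) (Fin 3) K) 2 0) < 1 := by
    intro hlt
    have hkN₁ := (mapGL_N₁_eq_iff_v_apply_two_zero_lt_one hvσ hϖ hk).2 hlt
    apply hcp
    rw [hc_eq, hp_eq, show u * κ = u * κ₀ * k by rw [hkdef, mul_assoc, mul_inv_cancel_left], latticeGraphIso_mul_apply]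
    congr 1
    exact Subtype.ext (by rw [latticeGraphIso_apply_val]; exact hkN₁)
  -- the matrix in the frame `uκ = u₀k` is `k⁻¹Y₀k`; its corner is a UNIT multiple of `ϖ` (★ K)
  have hconj : (u * κ)⁻¹ * γ * (u * κ) = k⁻¹ * γ₀ * k := by
    rw [hγ₀def, show u * κ = u * κ₀ * k by rw [hkdef, mul_assoc, mul_inv_cancel_left]]
    exact conj_mul_eq_inv_mul_conj_mul γ (u * κ₀) k
  have hMk : (((((u * κ : unitaryGroupOfForm σ ((StdForm.antidiagonal 3).over K)) : GL (Fin 3) K)⁻¹ : GL (Fin 3) K) : Matrix (Fin 3) (Fin 3) K) * (((γ : GL (Fin 3) K) : Matrix (Fin 3) (Fin 3) K) - 1) * (((u * κ : unitaryGroupOfForm σ ((StdForm.antidiagonal 3).over K)) : GL (Fin 3) K) : Matrix (Fin 3) (Fin 3) K)) =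
      (((k : GL (Fin 3) K)⁻¹ : GL (Fin 3) K) : Matrix (Fin 3) (Fin 3) K) * (((((u * κ₀ : unitaryGroupOfForm σ ((StdForm.antidiagonal 3).over K)) : GL (Fin 3) K)⁻¹ : GL (Fin 3) K) : Matrix (Fin 3) (Fin 3) K) * (((γ : GL (Fin 3) K) : Matrix (Fin 3) (Fin 3) K) - 1) * (((u * κ₀ : unitaryGroupOfForm σ ((StdForm.antidiagonal 3).over K)) : GL (Fin 3) K) : Matrix (Fin 3) (Fin 3) K)) * ((k : GL (Fin 3) K) : Matrix (Fin 3) (Fin 3) K) := by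
    rw [← coe_inv_mul_mul_sub_one γ (u * κ), ← hM₀, ← coe_inv_mul_mul_sub_one γ₀ k, hconj]
  have h20 : ¬ Valued.v ((((((u * κ : unitaryGroupOfForm σ ((StdForm.antidiagonal 3).over K)) : GL (Fin 3) K)⁻¹ : GL (Fin 3) K) : Matrix (Fin 3) (Fin 3) K) * (((γ : GL (Fin 3) K) : Matrix (Fin 3) (Fin 3) K) - 1) * (((u * κ : unitaryGroupOfForm σ ((StdForm.antidiagonal 3).over K)) : GL (Fin 3) K) : Matrix (Fin 3) (Fin 3) K)) 2 0) ≤ Valued.v ϖ ^ (1 + 1) := by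
    rw [hMk]
    exact fun h => hkN ((v_conj_apply_two_zero_le_iff_of_shape hvσ hϖ hres hY₀ hshape h02 hk).1 h)
  -- but `w` is a fixed child through `c' = (uκ)·N₁`: the residual test holds there (★ G3), i.e. the corner is `< |ϖ|`
  have hex : ∃ w' ∈ (latticeGraph σ ϖ ((StdForm.antidiagonal 3).over K)).neighborSet
        (latticeGraphIso σ ϖ ((StdForm.antidiagonal 3).over K) (u * κ) ⟨latt (Matrix.diagonal ![(1 : K), 1, ϖ]), 2, isVertexLattice_two_N₁_of_neg hσϖ hϖ⟩),
      w'.1 ≠ mapGL (u : GL (Fin 3) K) (stdLattice K 3) ∧ mapGL (γ : GL (Fin 3) K) w'.1 = w'.1 := by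
    refine ⟨w, ?_, ?_, (latticeGraphIso_eq_iff_mapGL_eq γ w).1 hwfix⟩
    · rw [SimpleGraph.mem_neighborSet, ← hc_eq]; exact hcw
    · intro h
      exact hne (Subtype.ext (by rw [latticeGraphIso_apply_val]; exact h))
  have htest := v_B₀_lt_one_of_exists_fixed_child_latticeGraphIso_of_congr hvσ hσϖ hϖ hres hγK hκ hγϖ hex
  rw [← inv_mul_mul_apply_two_zero_eq_B₀ κ, ← coe_inv_mul_mul_sub_one (u⁻¹ * γ * u) κ, ← conj_mul_eq_inv_mul_conj_mul γ u κ,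
    coe_inv_mul_mul_sub_one γ (u * κ)] at htest
  -- `|ϖ⁻¹ x| < 1 ⇒ |x| ≤ |ϖ|^2`
  apply h20
  have hx : Valued.v ((((((u * κ : unitaryGroupOfForm σ ((StdForm.antidiagonal 3).over K)) : GL (Fin 3) K)⁻¹ : GL (Fin 3) K) : Matrix (Fin 3) (Fin 3) K) * (((γ : GL (Fin 3) K) : Matrix (Fin 3) (Fin 3) K) - 1) * (((u * κ : unitaryGroupOfForm σ ((StdForm.antidiagonal 3).over K)) : GL (Fin 3) K) : Matrix (Fin 3) (Fin 3) K)) 2 0) < Valued.v ϖ := by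
    rw [map_mul, map_inv₀] at htest
    have h' := mul_lt_mul_of_pos_left htest (zero_lt_iff.2 hvϖ0)
    rwa [← mul_assoc, mul_inv_cancel₀ hvϖ0, one_mul, mul_one] at h'
  have hdm' : Valued.v ϖ = Valued.v ϖ ^ (1 + 1) * WithZero.exp (1 : ℤ) := by have h := hdm 1; rwa [pow_one] at h
  rw [hdm'] at hx
  exact (WithZero.lt_mul_exp_iff_le (pow_ne_zero _ hvϖ0)).1 hx

end Literature.NumberTheory.Automorphic.UnitaryLatticeTree

end
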